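import Literature.MathematicalPhysics.QuantumFieldTheory.Balaban1983to89.B9SectBGStepAtLettersV2
import Literature.MathematicalPhysics.QuantumFieldTheory.Balaban1983to89.B9Thm34HolderLeftFinal

/-!
# `Balaban1983to89.B9SectBGHolderLeftAtLetters` — [Balaban1985BackgroundPropagators] Sect. B, p. 407 × Theorem 3.3 (3.43): THE
# LEFT-ENTRY CLAUSE OF THE BOND-SECTOR FAMILY'S OWN `G(U′U)` AT THE LETTERS, KERNEL-FREE, AND THE (3.43)-TYPE HÖLDER MEMBERS OF
# `G(U′U)` WITH THE DERIVATIVE ON THE LEFT, PER PROBE (pub-ymgap N06 row 13, steps 13-H1(G) ∕ 13-E4(G) ∕ 13-H2(G): first brick)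

statement-level skeleton of published theorems with citation tags; proofs where landed; nothing here is a claim about the Yang–Mills mass gap

CITATION HEADER (lean-in-tree rule).  B9 = T. Bałaban, *Propagators for lattice gauge theories in a background field*, Commun. Math. Phys.
**99** (1985) 389–434 [Balaban1985BackgroundPropagators] (held `paper:balaban1985-cmp99-background-propagators`; journal page = PDF page + 388):
Theorem 3.4 p. 400 [PDF 12] L7–10 «There exists a positive constant a₁ such that the operators G′(U), (Q′(U)G′²(U)Q′*(U))⁻¹, R(U), G(U) extend
to configurations U′U for α₁ ≦ a₁ as analytic functions of A. The extended operators satisfy all the inequalities of Theorems 3.1–3.3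
correspondingly»; Theorem 3.3 p. 399 [PDF 11] «with G′(U) replaced by G(U) and λ replaced by a function J defined at bonds of the lattice»;
(3.43) p. 398 [PDF 10] «‖ζ∇_UG′(U)λ‖_β, ‖ζG′(U)∇*_Uλ‖_β ≦ B₀(β₀)(Lʲη)^{1−β}·(‖ζ‖_β^ξ + |ζ|)e^{−δ₀d(y,y′)}|λ|»; p. 407 [PDF 19] (3.82)–(3.86)
«G(U′U) = Σ_{n≥0} G(U)(V(A)G(U))ⁿ … Thus Theorem 3.4 is proved»; p. 403 [PDF 15] l. 1–9 «… and Lemma 2.1 of [4] we can prove all the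
statements (3.42)–(3.47) … of course with different constants»; p. 399 L1–3 «the constants … do not depend on the sequence {Ω_j}».
[4] = [Balaban1984PropagatorsII] (2.51) p. 232, Lemma 2.1 p. 234 with (2.59) p. 233.  Rows B9.Thm3.4 × B9.Thm3.3 ((3.42)/(3.43) cells) ×
B9.Eq3.82–3.86 × B6.Lemma2.1 (cells only; no row head changes).

WHY THIS FILE (pub-ymgap N06 row 13, seat dag-n06-c gen 6; `GSIDE-L2-SPEC.md` §G).  After FRAMES V6 (`B9SectBStepFrameV6.SectBFrame₆`) the
ONLY Sect.-B member-steps of the record's row-13 obligation still displayed are the three Hölder ∕ sup steps (3.43)–(3.45) of G(U′U)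
(`stepH1G stepE4G stepH2G`).  r06's G-side Hölder chain (FILES 54 §2, 55, 57-G: `thm34_all_holderLeft_uniform`, `thm34_all_holder_uniform`,
`thm34_all_holderInput_uniform`) routes through `B9Thm34AllUniform.thm34_all_uniform` and its KERNEL-FORM letters of G(U)
(`HasKernelBound`), which the lit-balaban desk (pub-ymgap ME #13, 2026-08-26) records as not satisfied by Bałaban's own propagators on
multi-point blocks — so no genuine instance can call them.  But the Hölder transfers themselves need NO kernel: the (3.43)-left transfer
is r06's `B9Thm34HolderLeftFinal.norm_probe_transfer` applied to a LEFT-ENTRY CLAUSE `X·G(U) ≺ B₀P e^{−δd} ⟹ X·G(U′U) ≺ B P e^{−δ′d}` (every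
left letter `X`, every weight `P ≧ 0`), and r06's kernel-free uniform G-clause `B9Thm34GUniformR1.thm34_G_clause_uniform` PROVIDES that
clause (and its right twin) for its extension `GExt` — which the letters dictionary `B9SectBGStepAtLettersV2.GFrame₂` identifies with the
family's own `G(U′U)` (uniqueness of two-sided inverses, the section identity `rZero_add_pPrime_sections`, `coord_mul`; the proof of
`entries342_ext_of_gFrame₂`, which however exports only four fixed entries, not the clause).  THIS FILE exports the clause itself at the
letters and derives the (3.43)-LEFT members of G(U′U) per probe — the G twin of `B9Thm34HolderGpUniformR1.thm34_Gp_holderLeft_uniform`,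
kernel-free.  (The right-derivative member of (3.43) and the input-Hölder members (3.44)/(3.45) of G(U′U) need, in addition, r06's
FILE 35 `thm34_G_holderRight_concreteV₃` ∕ FILE 38 devices `input344_of_inverse`, `input345_of_inverse` re-run on this clause and an «R1»
twin of `B9Thm34GKernelUniform.exists_threshold_pOne_uniform` — successor files; this one is their common first brick.)

WHAT IS PROVED (2 theorems + 2 private rate ∕ exponent bookkeeping lemmas: 0 `def`, 0 sorry, 0 new named facts; standard axioms):
* ★ **`clause_ext_of_gFrame₂`** — for every `GFrame₂` and Lemma-2.1 datum `(d261, h261)` (as in `entries342_ext_of_gFrame₂`), and every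
  positive input `(B₀, δ₀, B₁, δ₁)`: `∃ a₁ > 0 ∃ B ≧ 0` (before the member) such that at every (3.35)-regular U above `Mthr δr` with the
  (3.42) blocks of `Gp`, `GA` at (B₀, δ₀) and the (3.48) kernel of `Cinv` at (B₁, δ₁), and every U′ in (3.37) at `α₁ ≦ a₁`: (o) the
  family's `G(U′U)` inverts the frame's `Δ_a(U′U)` word on both sides; (L) THE LEFT-ENTRY CLAUSE: for every left letter `X` and weight
  `P ≧ 0`, `X·G(U) ≺ c_RG B₀·P·e^{−δr d} ⟹ X·G(U′U) ≺ B·P·e^{−(δr/6)d}`; (R) THE RIGHT-ENTRY CLAUSE: for every right letter `Y`,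
  `G(U)·Y ≺ c_RG B₀·Lʲη·e^{−δr d} ⟹ G(U′U)·Y ≺ B·Lʲη·e^{−(δr/6)d}`; `δr = min(min(δ₀, δ₁), δcap)`.
* ★★ **`holderLeft_G_ext_of_gFrame₂`** — THE (3.43)-TYPE HÖLDER MEMBERS OF G(U′U) WITH THE DERIVATIVE ON THE LEFT, PER PROBE, KERNEL-FREE:
  same prefix, `∃ a₁ > 0 ∃ B ≧ 0`, then for every left letter `D`, every `ℝ`-linear `𝔸`-valued functional `Φ` of the bond function,
  anchor `y ∋ p₀`, exponent `β`, sizes `B_h, c_ζ ≧ 0`: IF `‖Φ(D G(U)μ)‖ ≦ B_h(Lʲη)^{1−β}c_ζ e^{−δr d(y,y′)}|μ|` for every `μ` supported in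
  `Δ(y′)` ((3.43) FOR U read for this probe — the instance's transported Hölder quotient (3.40)) THEN `‖Φ(D G(U′U)μ)‖ ≦
  B·B_h(Lʲη)^{1−β}c_ζ e^{−(δr/6)d(y,y′)}|μ|`, `B = (Σ_i‖b_i‖)M₂·B_clause/(c_RG B₀)`.

PROOF.  `clause_ext_of_gFrame₂`: the proof of `B9SectBGStepAtLettersV2.entries342_ext_of_gFrame₂` up to its identification step (5),
verbatim (r06's `thm34_Gp_uniform` (R1) and `thm34_G_clause_uniform` (R1) at the rate `δr` and exponent `d261 δr`, BY NAME), exporting the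
two clauses instead of four entries.  `holderLeft_G_ext_of_gFrame₂`: `norm_probe_transfer` on clause (L), as in r06's FILE 54 §1.

HONEST SCOPE ∕ NOT CLAIMED.  `GFrame₂` is a HYPOTHESIS structure (the contract a letters instance meets), not shown inhabited; the
(3.43) members FOR U enter per probe as hypotheses; `Φ` is arbitrary (the instance takes the transported Hölder quotients (3.40) with
cut-offs, `B9Thm34HolderLeftFinal` §3); rates `δr → δr/6` are one admissible choice («with different constants», p. 403).  This is
NOT yet the (3.43) BLOCK-step `StepH1Pos … GA` of `B9SectBStepWhole` (that needs the right-derivative member too, successor file).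
Nothing of [B9] asserted; no row head changes; NOT a node discharge; nothing continuum ∕ OS ∕ mass-gap ∕ Clay.  Cell `pub-ymgap`
(HUMAN RULING D-0062), Track A node N06 [B9], N06-ASSIGNMENT row 13, seat `pub-ymgap-dag-n06-c` (g6), 2026-08-27.  Count-neutral.

RELATED IN THE TREE, NOT DUPLICATED (searched 2026-08-27: `lean search 'clause_ext_of_gFrame'` = ∅, `'holderLeft_G'` = ∅):
`B9SectBGStepAtLettersV2` (`GFrame₂`, `entries342_ext_of_gFrame₂` — the four-entry export; its two private bookkeeping lemmas are
re-proved here privately, 10 lines), `B9Thm34HolderLeftFinal.norm_probe_transfer`, `B9Thm34HolderGpUniformR1.thm34_Gp_holderLeft_uniform`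
(the G′ twin), `B9Thm34HolderLeftUniform.thm34_all_holderLeft_uniform` (r06's kernel-form G member, kept) — all USED BY NAME or
paralleled; no existing module modified.
-/

noncomputable section

namespace Literature.MathematicalPhysics.QuantumFieldTheory.Balaban1983to89.B9SectBGHolderLeftAtLetters

open Literature.MathematicalPhysics.QuantumFieldTheory.Balaban1983to89
open Literature.MathematicalPhysics.QuantumFieldTheory.Balaban1983to89.B6RandomWalk (HasMajorant hasMajorant_mono Triangle254 Ineq261)
open Literature.MathematicalPhysics.QuantumFieldTheory.Balaban1983to89.B6RandomWalkHom (HasMajorantHom)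
open Literature.MathematicalPhysics.QuantumFieldTheory.Balaban1983to89.B6RandomWalkSection (secExt secRes secConj secConj_def
  secRes_comp_secExt)
open Literature.MathematicalPhysics.QuantumFieldTheory.Balaban1983to89.B9Thm34Ext (toB6)
open Literature.MathematicalPhysics.QuantumFieldTheory.Balaban1983to89.B9Ineq347 (ScaleTransfer)
open Literature.MathematicalPhysics.QuantumFieldTheory.Balaban1983to89.B9Eq39Adjoint (covD covDstar prodCfg plaqU)
open Literature.MathematicalPhysics.QuantumFieldTheory.Balaban1983to89.B9Eq369Small (Through)
open Literature.MathematicalPhysics.QuantumFieldTheory.Balaban1983to89.B9Eq372Locality (stBonds)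
open Literature.MathematicalPhysics.QuantumFieldTheory.Balaban1983to89.B9Eq352DivForm (tauF tauB)
open Literature.MathematicalPhysics.QuantumFieldTheory.Balaban1983to89.B9Eq352DivFormLetters (conj)
open Literature.MathematicalPhysics.QuantumFieldTheory.Balaban1983to89.B9Eq352GradLetters (diffLetter)
open Literature.MathematicalPhysics.QuantumFieldTheory.Balaban1983to89.B9Eq371GradLetters (bT bU)
open Literature.MathematicalPhysics.QuantumFieldTheory.Balaban1983to89.B9Eq372RemLetters (lapDDLetter)
open Literature.MathematicalPhysics.QuantumFieldTheory.Balaban1983to89.B9Eq382V3Letters (dPrimeLetter)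
open Literature.MathematicalPhysics.QuantumFieldTheory.Balaban1983to89.B9Eq376POneLetters (conjHom gradLin divLin)
open Literature.MathematicalPhysics.QuantumFieldTheory.Balaban1983to89.B9Eq386Neumann (pTwo deltaA)
open Literature.MathematicalPhysics.QuantumFieldTheory.Balaban1983to89.B9Eq360Vprime (gPrimeExtEnd pPrime pOp)
open Literature.MathematicalPhysics.QuantumFieldTheory.Balaban1983to89.B9Eq360VprimeLetters (vPrimeConc)
open Literature.MathematicalPhysics.QuantumFieldTheory.Balaban1983to89.B9Thm34SectBUniformR1 (thm34_Gp_uniform)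
open Literature.MathematicalPhysics.QuantumFieldTheory.Balaban1983to89.B9Thm34GUniformR1 (thm34_G_clause_uniform)
open Literature.MathematicalPhysics.QuantumFieldTheory.Balaban1983to89.B6RandomWalkKernel (HasKernelBound hasKernelBound_mono)
open Literature.MathematicalPhysics.QuantumFieldTheory.Balaban1983to89.B9FromB6 (EBlock)
open Literature.MathematicalPhysics.QuantumFieldTheory.Balaban1983to89.B9SectBStepWhole (StepPos StepEPos)
open Literature.MathematicalPhysics.QuantumFieldTheory.Balaban1983to89.B9SectBGpStepAtLettersV2 (GpFrame₂ CinvFrame₂)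
open Literature.MathematicalPhysics.QuantumFieldTheory.Balaban1983to89.B9SectBGStepAtLetters (rZero_add_pPrime_sections)
open Literature.MathematicalPhysics.QuantumFieldTheory.Balaban1983to89.B6RandomWalk (BlockSupp)
open Literature.MathematicalPhysics.QuantumFieldTheory.Balaban1983to89.B9Eq352DivFormLetters (coordEquiv)
open Literature.MathematicalPhysics.QuantumFieldTheory.Balaban1983to89.B9SectBGStepAtLettersV2 (GFrame₂)
open Literature.MathematicalPhysics.QuantumFieldTheory.Balaban1983to89.B9Thm34HolderLeftFinal (norm_probe_transfer)

universe u

variable {I : Type} {c35 : ℝ} {geo : I → B9.Geometry} {bg : I → B9.Backgrounds}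
  {Gp : ∀ i, B9.KernelFamily (geo i) (bg i)}
  {𝔸 : Type u} [NormedRing 𝔸] [NormedAlgebra ℂ 𝔸] [CompleteSpace 𝔸] {ι : Type} [Fintype ι] [DecidableEq ι]
  {b : Module.Basis ι ℝ 𝔸} {κ : Type} [Fintype κ] [LinearOrder κ]
  {S : I → Type} [∀ i, Fintype (S i)] [∀ i, DecidableEq (S i)]
  [∀ i, Fintype (geo i).Site] [∀ i, DecidableEq (geo i).Site] [∀ i, Nonempty (geo i).Site]

/-- Rate bookkeeping for block majorants: a majorant `c·P(a)·e^{−δd}` with `c·P ≧ 0` stays one at any smaller rate `δ′ ≦ δ`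
(d ≧ 0). [folklore] [cite: Balaban1984PropagatorsII, (2.51) p.232] -/
private theorem hasMajorant_rate_le {g : B6.Geometry} {X : Type} (blk : X → g.Site) {T : Module.End ℝ (X → ℝ)}
    {c δ δ' : ℝ} (P : g.Site → ℝ) (hc : ∀ a, 0 ≤ c * P a) (hδ : δ' ≤ δ) (hd : ∀ a a' : g.Site, 0 ≤ g.dist a a')
    (h : HasMajorant blk T (fun a a' => c * P a * Real.exp (-(δ * g.dist a a')))) :
    HasMajorant blk T (fun a a' => c * P a * Real.exp (-(δ' * g.dist a a'))) :=
  hasMajorant_mono blk h fun a a' =>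
    mul_le_mul_of_nonneg_left (Real.exp_le_exp.2 (by nlinarith [hd a a', hδ])) (hc a)

/-- The (3.48)-type kernel bound `|T(y,y′)| ≦ c(Lʲη)⁻⁴(L^{j′}η)^{−d}E(y,y′)` w.r.t. the volume pairing `vol g d` is the SAME inequality
on the matrix entries for every exponent `d` (the factor `(L^{j′}η)^{−d}` IS the reciprocal pairing weight): exponent change `d ↦ D`.
Used to call the r06 chain at a Lemma-2.1 exponent decoupled from the frame's (3.48) exponent `dB`. [folklore]
[cite: Balaban1985BackgroundPropagators, Thm 3.2 (3.48) p.398] -/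
private theorem kerBound_exp_change {g : B9.Geometry} [Fintype g.Site] [DecidableEq g.Site]
    (hlen : ∀ y : g.Site, 0 < g.len y) (T : Module.End ℝ (g.Site → ℝ)) {c : ℝ} {E : g.Site → g.Site → ℝ} (d D : ℕ)
    (h : ∀ y y' : g.Site, |B9Thm34Inv.ker (B9Thm34Inv.vol g d) T y y'| ≤
      c * g.len y ^ (-(4 : ℝ)) * g.len y' ^ (-(d : ℝ)) * E y y') :
    ∀ y y' : g.Site, |B9Thm34Inv.ker (B9Thm34Inv.vol g D) T y y'| ≤
      c * g.len y ^ (-(4 : ℝ)) * g.len y' ^ (-(D : ℝ)) * E y y' := by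
  intro y y'
  have hv : ∀ n : ℕ, 0 < B9Thm34Inv.vol g n y' := fun n => B9Thm34Inv.vol_pos n hlen y'
  have h1 := h y y'
  rw [← B9Thm34Inv.vol_inv d hlen y', show c * g.len y ^ (-(4 : ℝ)) * (B9Thm34Inv.vol g d y')⁻¹ * E y y' =
      (c * g.len y ^ (-(4 : ℝ)) * E y y') * (B9Thm34Inv.vol g d y')⁻¹ by ring] at h1
  have key : |B9Thm34Inv.entry T y y'| ≤ c * g.len y ^ (-(4 : ℝ)) * E y y' :=
    (B9Thm34Inv.ker_le_iff _ (hv d) T y _).1 h1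
  have h2 := (B9Thm34Inv.ker_le_iff _ (hv D) T y _).2 key
  rw [B9Thm34Inv.vol_inv D hlen y'] at h2
  calc |B9Thm34Inv.ker (B9Thm34Inv.vol g D) T y y'| ≤ (c * g.len y ^ (-(4 : ℝ)) * E y y') * g.len y' ^ (-(D : ℝ)) := h2
    _ = c * g.len y ^ (-(4 : ℝ)) * g.len y' ^ (-(D : ℝ)) * E y y' := by ring

/-! ## ★ The two entry clauses of the family's own G(U′U) at the letters -/

/-- ★ **THE LEFT- AND RIGHT-ENTRY CLAUSES OF THE BOND-SECTOR FAMILY'S `G(U′U)` AT THE LETTERS, KERNEL-FREE** (Sect. B p. 407: (3.86)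
«G(U′U) = Σ_{n≥0} G(U)(V(A)G(U))ⁿ», Theorem 3.4 p. 400, «of course with different constants» p. 403): for every letters dictionary
`GFrame₂`, Lemma-2.1 datum `(d261, h261)` and positive input `(B₀, δ₀, B₁, δ₁)` there are `a₁ > 0`, `B ≧ 0` (before the member) such
that at every (3.35)-regular U above the threshold with the (3.42) blocks of `Gp`, `GA` at (B₀, δ₀) and the (3.48) kernel of `Cinv` at
(B₁, δ₁), and every U′ in (3.37) at `α₁ ≦ a₁`: (o) `Δ_a(U′U)·G(U′U) = 1 = G(U′U)·Δ_a(U′U)` for the frame's word `F.DeltaA`; (L) for every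
left letter `X` and weight `P ≧ 0`, `X·G(U) ≺ c_RG B₀ P e^{−δr d} ⟹ X·G(U′U) ≺ B P e^{−(δr/6)d}`; (R) for every right letter `Y`,
`G(U)Y ≺ c_RG B₀ Lʲη e^{−δr d} ⟹ G(U′U)Y ≺ B Lʲη e^{−(δr/6)d}` (`δr = min(min(δ₀,δ₁),δcap)`).  Proof = `entries342_ext_of_gFrame₂`'s,
exporting r06's clauses (`thm34_G_clause_uniform`, R1) after the three uniqueness identifications.
[cite: Balaban1985BackgroundPropagators, Thm 3.4 p.400 + Thm 3.3 p.399 + (3.80)–(3.86) p.407 + (3.57)–(3.68) pp.402–403 + Thm 3.1 (3.42) p.397 + Thm 3.11 p.416; Balaban1984PropagatorsII, (2.51) p.232 + Lemma 2.1 (2.61) p.234] -/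
theorem clause_ext_of_gFrame₂ {GA : ∀ i, B9.KernelFamily (geo i) (bg i)} {Cinv : ∀ i, B9.SiteKernel (geo i) (bg i)}
    (F : GFrame₂ c35 geo bg Gp b κ S GA Cinv) (d261 : ℝ → ℕ)
    (h261 : ∀ (i : I) (δ α : ℝ), 0 < δ → δ ≤ F.δcap → 9 / 5000 ≤ α → α < 1 → F.M261 δ ≤ (geo i).M →
      Ineq261 (d261 δ) (toB6 (geo i) (F.Rr i) (F.Hp i)) δ α)
    {B₀ δ₀ B₁ δ₁ : ℝ} (hB₀ : 0 < B₀) (hδ₀ : 0 < δ₀) (hB₁ : 0 < B₁) (hδ₁ : 0 < δ₁) :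

    ∃ a₁ : ℝ, 0 < a₁ ∧ ∃ B : ℝ, 0 ≤ B ∧
      ∀ (i : I) (α₀ : ℝ) (U : (bg i).Cfg), F.Mthr (min (min δ₀ δ₁) F.δcap) ≤ (geo i).M → 0 < α₀ → (geo i).M * α₀ ≤ F.aInv →
        (bg i).Reg335 c35 α₀ U → EBlock (Gp i) B₀ δ₀ U →
        (∀ y y' : (geo i).Site, |(Cinv i).ker U y y'| ≤
          B₁ * ((geo i).len y) ^ (-(4 : ℝ)) * ((geo i).len y') ^ (-(F.dB : ℝ)) * Real.exp (-(δ₁ * (geo i).dist y y'))) →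
        EBlock (GA i) B₀ δ₀ U →
        ∀ (α₁ : ℝ) (U' : (bg i).Cfg), 0 < α₁ → α₁ ≤ a₁ → (bg i).Cplx337 α₁ U U' →
          (F.DeltaA i ((bg i).mul U' U) * F.Gb i ((bg i).mul U' U) = 1 ∧
            F.Gb i ((bg i).mul U' U) * F.DeltaA i ((bg i).mul U' U) = 1) ∧
          (∀ (X : Module.End ℝ ((κ × S i) × ι → ℝ)) (P : (geo i).Site → ℝ), (∀ y, 0 ≤ P y) →
            HasMajorant (g := toB6 (geo i) (F.Rr i) (F.Hp i)) (fun q : (κ × S i) × ι => F.blk i q.1.2) (X * F.Gb i U)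
              (fun a a' => F.cRG * B₀ * P a * Real.exp (-(min (min δ₀ δ₁) F.δcap * (geo i).dist a a'))) →
            HasMajorant (g := toB6 (geo i) (F.Rr i) (F.Hp i)) (fun q : (κ × S i) × ι => F.blk i q.1.2)
              (X * F.Gb i ((bg i).mul U' U))
              (fun a a' => B * P a * Real.exp (-(min (min δ₀ δ₁) F.δcap / 6 * (geo i).dist a a')))) ∧
          (∀ Y : Module.End ℝ ((κ × S i) × ι → ℝ),
            HasMajorant (g := toB6 (geo i) (F.Rr i) (F.Hp i)) (fun q : (κ × S i) × ι => F.blk i q.1.2) (F.Gb i U * Y)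
              (fun a a' => F.cRG * B₀ * (geo i).len a * Real.exp (-(min (min δ₀ δ₁) F.δcap * (geo i).dist a a'))) →
            HasMajorant (g := toB6 (geo i) (F.Rr i) (F.Hp i)) (fun q : (κ × S i) × ι => F.blk i q.1.2)
              (F.Gb i ((bg i).mul U' U) * Y)
              (fun a a' => B * (geo i).len a * Real.exp (-(min (min δ₀ δ₁) F.δcap / 6 * (geo i).dist a a')))) := by
  classical
  -- the common rate of the call
  have hδr : 0 < min (min δ₀ δ₁) F.δcap := lt_min (lt_min hδ₀ hδ₁) F.δcap_pos
  have hδr0 : min (min δ₀ δ₁) F.δcap ≤ δ₀ := le_trans (min_le_left _ _) (min_le_left _ _)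
  have hδr1 : min (min δ₀ δ₁) F.δcap ≤ δ₁ := le_trans (min_le_left _ _) (min_le_right _ _)
  have hδrc : min (min δ₀ δ₁) F.δcap ≤ F.δcap := min_le_right _ _
  have hBG : 0 < F.cR * B₀ := mul_pos F.cR_pos hB₀
  have hBb : 0 < F.cRG * B₀ := mul_pos F.cRG_pos hB₀
  have hBK : 0 < F.cK * B₁ := mul_pos F.cK_pos hB₁
  -- r06's uniform Theorem-3.4 clauses: G′ (for the inverse identities of the extension) and G
  obtain ⟨a₁, ha₁, B', -, H'⟩ := thm34_Gp_uniform b κ (d261 (min (min δ₀ δ₁) F.δcap)) (min (min δ₀ δ₁) F.δcap) (F.cR * B₀) F.Cq F.a₀ F.d₀ F.M₂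
    (F.Λf (min (min δ₀ δ₁) F.δcap)) hBG F.Cq_nonneg F.a₀_nonneg F.M₂_nonneg hδr
    (fun α hα => F.Λf_one_le _ α hδr hα) F.hrepr
  obtain ⟨a₂, ha₂, B, hB, H⟩ := thm34_G_clause_uniform b κ (d261 (min (min δ₀ δ₁) F.δcap)) (min (min δ₀ δ₁) F.δcap) (F.cRG * B₀) F.κQ (F.cR * B₀)
    (F.cK * B₁) F.cF F.Cq F.a₀ F.C₀ F.d₀ F.M₂ F.κQb F.cFb F.abar (F.Λf (min (min δ₀ δ₁) F.δcap)) hBb.le F.κQ_pos hBG hBK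
    F.cF_pos F.Cq_nonneg F.a₀_nonneg F.C₀_nonneg F.M₂_nonneg hδr F.κQb_nonneg F.cFb_nonneg F.abar_nonneg
    (fun α hα => F.Λf_one_le _ α hδr hα) F.hrepr
  refine ⟨min a₁ a₂, lt_min ha₁ ha₂, B, hB, ?_⟩
  intro i α₀ U hM0 hα₀ hMa hU hEp hKer hEG α₁ U' hα₁ ha hU'
  have hM : F.MInv ≤ (geo i).M := F.MInv_le_of_Mthr_le hM0
  have ha1 : α₁ ≤ a₁ := le_trans ha (min_le_left _ _)
  have ha2 : α₁ ≤ a₂ := le_trans ha (min_le_right _ _)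
  -- the site-sector letters at U: G′(U) inverts Δ′_a(U); (3.42)₀,₁,₂ of G′ at δ₀ lowered to δr
  obtain ⟨hΔG, hGΔ⟩ := F.reg_inv i α₀ U hM hα₀ hMa hU
  obtain ⟨h1, h2, h3, -⟩ := F.read342 i α₀ U B₀ δ₀ hM hα₀ hMa hU hB₀ hδ₀ hEp
  have hc2 : ∀ a : (geo i).Site, 0 ≤ F.cR * B₀ * (geo i).len a ^ 2 := fun a => mul_nonneg hBG.le (sq_nonneg _)
  have hc1 : ∀ a : (geo i).Site, 0 ≤ F.cR * B₀ * (geo i).len a := fun a => mul_nonneg hBG.le (F.len_pos i a).le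
  have h1' := hasMajorant_rate_le (g := toB6 (geo i) (F.Rr i) (F.Hp i)) (fun p : S i × ι => F.blk i p.1)
    (fun a => (geo i).len a ^ 2) hc2 hδr0 (F.dist_nonneg i) h1
  have h2' := fun k => hasMajorant_rate_le (g := toB6 (geo i) (F.Rr i) (F.Hp i)) (fun p : S i × ι => F.blk i p.1)
    (fun a => (geo i).len a) hc1 hδr0 (F.dist_nonneg i) (h2 k)
  have h3' := fun k => hasMajorant_rate_le (g := toB6 (geo i) (F.Rr i) (F.Hp i)) (fun p : S i × ι => F.blk i p.1)
    (fun a => (geo i).len a) hc1 hδr0 (F.dist_nonneg i) (h3 k)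
  -- the (3.48) kernel of C⁻¹(U) at δ₁ lowered to δr
  have hK := F.readKer i α₀ U B₁ δ₁ hM hα₀ hMa hU hB₁ hδ₁ hKer
  have hK' : ∀ y y' : (geo i).Site, |B9Thm34Inv.ker (B9Thm34Inv.vol (geo i) F.dB) (F.Cop i U) y y'| ≤
      F.cK * B₁ * (geo i).len y ^ (-(4 : ℝ)) * (geo i).len y' ^ (-(F.dB : ℝ)) *
        Real.exp (-(min (min δ₀ δ₁) F.δcap * (geo i).dist y y')) := by
    intro y y'
    refine (hK y y').trans (mul_le_mul_of_nonneg_left (Real.exp_le_exp.2 ?_) ?_)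
    · nlinarith [F.dist_nonneg i y y', hδr1]
    · exact mul_nonneg (mul_nonneg hBK.le (Real.rpow_nonneg (F.len_pos i y).le _))
        (Real.rpow_nonneg (F.len_pos i y').le _)
  -- the Lemma-2.1 exponent of the call is `d261 δr`, decoupled from the (3.48) exponent `dB`: the kernel bound is exponent-free
  have hK'' := kerBound_exp_change (F.len_pos i) (F.Cop i U) F.dB (d261 (min (min δ₀ δ₁) F.δcap)) hK'
  -- the bond-sector letters at U: G(U) inverts Δ_a(U); (3.42) of G at δ₀ lowered to δr; (3.15) sizes at δr
  obtain ⟨hΔGb, hGbΔ⟩ := F.reg_ginv i α₀ U hM hα₀ hMa hU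
  obtain ⟨g1, g2, g3, -⟩ := F.readG342 i α₀ U B₀ δ₀ hM hα₀ hMa hU hB₀ hδ₀ hEG
  have hb2 : ∀ a : (geo i).Site, 0 ≤ F.cRG * B₀ * (geo i).len a ^ 2 := fun a => mul_nonneg hBb.le (sq_nonneg _)
  have hb1 : ∀ a : (geo i).Site, 0 ≤ F.cRG * B₀ * (geo i).len a := fun a => mul_nonneg hBb.le (F.len_pos i a).le
  have g1' := hasMajorant_rate_le (g := toB6 (geo i) (F.Rr i) (F.Hp i)) (fun q : (κ × S i) × ι => F.blk i q.1.2)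
    (fun a => (geo i).len a ^ 2) hb2 hδr0 (F.dist_nonneg i) g1
  have g2' := fun k => hasMajorant_rate_le (g := toB6 (geo i) (F.Rr i) (F.Hp i)) (fun q : (κ × S i) × ι => F.blk i q.1.2)
    (fun a => (geo i).len a) hb1 hδr0 (F.dist_nonneg i) (g2 k)
  have g3' := fun k => hasMajorant_rate_le (g := toB6 (geo i) (F.Rr i) (F.Hp i)) (fun q : (κ × S i) × ι => F.blk i q.1.2)
    (fun a => (geo i).len a) hb1 hδr0 (F.dist_nonneg i) (g3 k)
  have hQb := F.hQb i U _ hδr hδrc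
  have hQsb := F.hQsb i U _ hδr hδrc
  -- the class (3.37) read blockwise; the (3.57), (3.80)–(3.81) letters; (3.35) on plaquettes
  obtain ⟨hkF, hsF, h337B, h337F, h337Bτ, hA, hAτB⟩ := F.cplx i α₁ U U' hα₁ hU'
  obtain ⟨h337B', h337FB, hAτF, hAFB, hAst, hAloc, hdAst⟩ := F.cplxG i α₁ U U' hα₁ hU'
  obtain ⟨hQm, hQsm⟩ := F.q_mul i α₁ U U' hα₁ hU'
  obtain ⟨hFc, hFcs⟩ := F.hF i α₁ U U' hα₁ hU'
  obtain ⟨hQbm, hQsbm⟩ := F.qb_mul i α₁ U U' hα₁ hU'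
  obtain ⟨hF₂, hF₂s⟩ := F.hF₂ i α₁ U U' hα₁ hU' _ hδr hδrc
  have h35 := F.reg335 i α₀ U hM hα₀ hMa hU
  -- the G′ clause: the inverse identities of the extension ⇒ the family's G′(U′U) is r06's extension
  obtain ⟨hinv1, hinv2, -, -⟩ := H' (F.T i) (F.coord i U) (F.blk i) (F.kQ i U) (F.sQ i U) (F.cfun i) (F.w i U)
    (F.dist_nonneg i) (F.triangle i) (F.dist_self i) (F.dist_comm i) (F.len_pos i) (F.eta_le_len i) (F.eta_pos i)
    (fun α hα hα1 => h261 i _ α hδr hδrc hα hα1 (F.M261_le_of_Mthr_le hM0)) (F.hST_of i hδr hδrc hM0) (F.unitary i U)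
    (F.stencilB i) (F.stencilF i) (F.stencil0 i) (F.w_nonneg i U) (F.card_w i U) (F.hkQ i U) (F.hsQ i U) (F.hcfun i)
    hΔG hGΔ h1' h2' h3' α₁ hα₁.le ha1 (F.expA i U U') (F.kF i U U') (F.sF i U U')
    hkF hsF h337B h337F h337Bτ hA hAτB
  have hGp := F.gop_eq i ((bg i).mul U' U) _ _ (F.mul_law i α₁ U U' hα₁ hU') hinv1 hinv2
  -- the G clause
  obtain ⟨Tinv, GExt, hT1, hT2, hG1, hG2, hleft, hright⟩ := H (F.T i) (F.coord i U) (F.blk i) (F.kQ i U) (F.sQ i U)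
    (F.cfun i) (F.w i U)
    (F.dist_nonneg i) (F.triangle i) (F.dist_self i) (F.dist_comm i) (F.len_pos i) (F.eta_le_len i) (F.eta_pos i)
    (F.L_one_le i) (fun α hα hα1 => h261 i _ α hδr hδrc hα hα1 (F.M261_le_of_Mthr_le hM0)) (F.hST_of i hδr hδrc hM0) (F.T_comm i)
    (F.unitary i U) h35 (F.stencilB i) (F.stencilF i) (F.stencilFB i) (F.stencilSt i) (F.stencilLoc i) (F.stencil0 i)
    (F.w_nonneg i U) (F.card_w i U) (F.hkQ i U) (F.hsQ i U) (F.hcfun i)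
    h1' h2' h3' (F.rep i) (F.hrep i) (F.hQc i U) (F.hQcs i U) (F.reg_cinv i α₀ U hM hα₀ hMa hU) hK''
    hQb hQsb (F.ha324 i) hΔGb hGbΔ g1' g2' g3' α₁ hα₁.le ha2 (F.expA i U U') (F.kF i U U') (F.sF i U U')
    hkF hsF h337B h337F h337B' h337Bτ h337FB hA hAτB hAτF hAFB hAst hAloc hdAst hQm hQsm hFc hFcs hQbm hQsbm rfl hF₂ hF₂s
  -- (1) G′(U′U) = r06's extension; (2) C⁻¹(U′U) = r06's Tinv
  rw [← hGp] at hT1 hT2 hG1 hG2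
  have hC := F.cop_eq i ((bg i).mul U' U) _ Tinv rfl hT1 hT2
  rw [← hC] at hG1 hG2
  -- (3) the section identity: R₀ + P′(A) through `rep` is P(U′U) read directly; (4) the background of U′U
  have hinj : Function.Injective (F.rep i) := fun y₁ y₂ h => by
    have e := congrArg (fun p : S i × ι => F.blk i p.1) h
    simpa only [F.hrep] using e
  rw [rZero_add_pPrime_sections hinj, ← F.coord_mul i α₁ U U' hα₁ hU'] at hG1 hG2
  -- (5) G(U′U) = r06's GExt
  have hGb := F.gb_eq i ((bg i).mul U' U) _ GExt rfl hG1 hG2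
  rw [← hGb] at hleft hright hG1 hG2
  exact ⟨⟨hG1, hG2⟩, hleft, hright⟩

/-! ## ★★ The (3.43)-type Hölder members of G(U′U) with the derivative on the left, per probe -/

/-- ★★ **THEOREM 3.4 × THEOREM 3.3, THE (3.43)-TYPE HÖLDER MEMBERS OF THE FAMILY'S `G(U′U)` WITH THE DERIVATIVE ON THE LEFT, PER PROBE,
KERNEL-FREE** («‖ζ∇_UG(U)λ‖_β ≦ B₀(β₀)(Lʲη)^{1−β}(‖ζ‖_β^ξ + |ζ|)e^{−δ₀d(y,y′)}|λ|», (3.43) p. 398 with Theorem 3.3 p. 399; for `U′U`: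
Theorem 3.4 p. 400; «the constants … do not depend on the sequence {Ω_j}», p. 399): for every `GFrame₂`, Lemma-2.1 datum and positive
input there are `a₁ > 0`, `B ≧ 0` such that, at every member ∕ background ∕ U′ as in `clause_ext_of_gFrame₂`, for every left letter
`D`, every `ℝ`-linear `𝔸`-valued functional `Φ` of the bond function, anchor `y ∋ p₀`, exponent `β`, sizes `B_h, c_ζ ≧ 0`: IF
`‖Φ(D G(U)μ)‖ ≦ B_h(Lʲη)^{1−β}c_ζe^{−δr d(y,y′)}|μ|` for every `μ` supported in `Δ(y′)` THEN `‖Φ(D G(U′U)μ)‖ ≦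
B·B_h(Lʲη)^{1−β}c_ζe^{−(δr/6)d(y,y′)}|μ|` (`B = (Σ_i‖b_i‖)M₂B_clause/(c_RG B₀)`) — `norm_probe_transfer` on clause (L); the G twin of
`thm34_Gp_holderLeft_uniform`, without kernel-form letters.
[cite: Balaban1985BackgroundPropagators, Thm 3.4 p.400 + p.399 + Thm 3.3 p.399 + Thm 3.1 (3.43) p.398 + (3.40) p.397 + (3.82)–(3.86) p.407 + p.403 l.1–9; Balaban1984PropagatorsII, (2.51) p.232 + Lemma 2.1 p.234] -/
theorem holderLeft_G_ext_of_gFrame₂ {GA : ∀ i, B9.KernelFamily (geo i) (bg i)} {Cinv : ∀ i, B9.SiteKernel (geo i) (bg i)}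
    (F : GFrame₂ c35 geo bg Gp b κ S GA Cinv) (d261 : ℝ → ℕ)
    (h261 : ∀ (i : I) (δ α : ℝ), 0 < δ → δ ≤ F.δcap → 9 / 5000 ≤ α → α < 1 → F.M261 δ ≤ (geo i).M →
      Ineq261 (d261 δ) (toB6 (geo i) (F.Rr i) (F.Hp i)) δ α)
    {B₀ δ₀ B₁ δ₁ : ℝ} (hB₀ : 0 < B₀) (hδ₀ : 0 < δ₀) (hB₁ : 0 < B₁) (hδ₁ : 0 < δ₁) :

    ∃ a₁ : ℝ, 0 < a₁ ∧ ∃ B : ℝ, 0 ≤ B ∧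
      ∀ (i : I) (α₀ : ℝ) (U : (bg i).Cfg), F.Mthr (min (min δ₀ δ₁) F.δcap) ≤ (geo i).M → 0 < α₀ → (geo i).M * α₀ ≤ F.aInv →
        (bg i).Reg335 c35 α₀ U → EBlock (Gp i) B₀ δ₀ U →
        (∀ y y' : (geo i).Site, |(Cinv i).ker U y y'| ≤
          B₁ * ((geo i).len y) ^ (-(4 : ℝ)) * ((geo i).len y') ^ (-(F.dB : ℝ)) * Real.exp (-(δ₁ * (geo i).dist y y'))) →
        EBlock (GA i) B₀ δ₀ U →
        ∀ (α₁ : ℝ) (U' : (bg i).Cfg), 0 < α₁ → α₁ ≤ a₁ → (bg i).Cplx337 α₁ U U' →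
        ∀ (D : Module.End ℝ ((κ × S i) × ι → ℝ)) (Φ : (κ × S i → 𝔸) →ₗ[ℝ] 𝔸) (y : (geo i).Site) (p₀ : (κ × S i) × ι),
          F.blk i p₀.1.2 = y →
        ∀ (β Bh cζ : ℝ), 0 ≤ Bh → 0 ≤ cζ →
          (∀ (y' : (geo i).Site) (μ : (κ × S i) × ι → ℝ) (M : ℝ),
            BlockSupp (g := toB6 (geo i) (F.Rr i) (F.Hp i)) (fun q : (κ × S i) × ι => F.blk i q.1.2) μ y' M →
            ‖Φ ((coordEquiv b).symm (D (F.Gb i U μ)))‖ ≤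
              Bh * (geo i).len y ^ (1 - β) * cζ * Real.exp (-(min (min δ₀ δ₁) F.δcap * (geo i).dist y y')) * M) →
          ∀ (y' : (geo i).Site) (μ : (κ × S i) × ι → ℝ) (M : ℝ),
            BlockSupp (g := toB6 (geo i) (F.Rr i) (F.Hp i)) (fun q : (κ × S i) × ι => F.blk i q.1.2) μ y' M →
            ‖Φ ((coordEquiv b).symm (D (F.Gb i ((bg i).mul U' U) μ)))‖ ≤
              B * Bh * (geo i).len y ^ (1 - β) * cζ * Real.exp (-(min (min δ₀ δ₁) F.δcap / 6 * (geo i).dist y y')) * M := by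
  classical
  obtain ⟨a₁, ha₁, B, hB, H⟩ := clause_ext_of_gFrame₂ F d261 h261 hB₀ hδ₀ hB₁ hδ₁
  have hSb : 0 ≤ ∑ j, ‖b j‖ := Finset.sum_nonneg fun j _ => norm_nonneg _
  have hBG : 0 < F.cRG * B₀ := mul_pos F.cRG_pos hB₀
  refine ⟨a₁, ha₁, (∑ j, ‖b j‖) * F.M₂ * (B / (F.cRG * B₀)),
    mul_nonneg (mul_nonneg hSb F.M₂_nonneg) (div_nonneg hB hBG.le), ?_⟩
  intro i α₀ U hM0 hα₀ hMa hU hEp hKer hEG α₁ U' hα₁ ha hU' D Φ y p₀ hp₀ β Bh cζ hBh hcζ hhyp y' μ M hμ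
  obtain ⟨-, hleft, -⟩ := H i α₀ U hM0 hα₀ hMa hU hEp hKer hEG α₁ U' hα₁ ha hU'
  have hc : 0 ≤ Bh * (geo i).len y ^ (1 - β) * cζ :=
    mul_nonneg (mul_nonneg hBh (Real.rpow_nonneg (F.len_pos i y).le _)) hcζ
  have key := norm_probe_transfer b (G := toB6 (geo i) (F.Rr i) (F.Hp i)) (fun q : (κ × S i) × ι => F.blk i q.1.2)
    (G₁ := F.Gb i U) (G₂ := F.Gb i ((bg i).mul U' U))
    (E₁ := fun a a' => Real.exp (-(min (min δ₀ δ₁) F.δcap * (geo i).dist a a')))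
    (E₂ := fun a a' => Real.exp (-(min (min δ₀ δ₁) F.δcap / 6 * (geo i).dist a a')))
    hBG F.M₂_nonneg (fun a a' => Real.exp_nonneg _) F.hrepr hleft D Φ p₀ hc (fun z ν C hν => by
      have h1 := hhyp z ν C hν
      rw [show (geo i).dist y z = (geo i).dist (F.blk i p₀.1.2) z by rw [hp₀]] at h1
      simpa only [mul_assoc] using h1) y' μ M hμ
  rw [hp₀] at key
  calc ‖Φ ((coordEquiv b).symm (D (F.Gb i ((bg i).mul U' U) μ)))‖
      ≤ (∑ j, ‖b j‖) * F.M₂ * (B / (F.cRG * B₀)) * (Bh * (geo i).len y ^ (1 - β) * cζ) *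
          Real.exp (-(min (min δ₀ δ₁) F.δcap / 6 * (geo i).dist y y')) * M := key
    _ = (∑ j, ‖b j‖) * F.M₂ * (B / (F.cRG * B₀)) * Bh * (geo i).len y ^ (1 - β) * cζ *
          Real.exp (-(min (min δ₀ δ₁) F.δcap / 6 * (geo i).dist y y')) * M := by ring

end Literature.MathematicalPhysics.QuantumFieldTheory.Balaban1983to89.B9SectBGHolderLeftAtLetters
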